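import Summits.Ventures.YMGap.Thresholds.HaarSixthMoment
import HarnessLib

/-!
# The Haar EIGHTH moment of the `SU(2)` character: `∫ (Re tr U)⁸ dU = 14`, i.e. `E[(½ Re tr U_p)⁸] = 7/128`
# (row type C-PRESS, endpoint `β = 0`, part 18: the Catalan moments `1, 2, 5, 14` of orders `2, 4, 6, 8`)

Cell `pub-ymgap`, seat ds-1 (gen 11). HONEST FRAMING: pure compact-group integration for a compact group `G ≅ SU(2)`
(`IsSpecialUnitaryModel ρ`); nothing lattice-specific, nothing about the continuum or the Clay problem. Kernel theorems only,
0 compute, no definitions.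

Same method as parts 10 and 17, one degree up, now with TWO rotation angles. With the unit quaternion
`x = (Re U₀₀, Im U₀₀, Re U₀₁, Im U₀₁)` and `m₈ := ∫ x₀⁸`: the twists `q = i, j, k` give `∫ x_a⁸ = m₈` and the swap `∫ x₀² x_a⁶ = ∫ x₀⁶ x_a²`;
the rotations `q = (3 ± 4e_a)/5` AND `q = (5 ± 12e_a)/13` give `∫((3x₀ ∓ 4x_a)/5)⁸ = m₈ = ∫((5x₀ ∓ 12x_a)/13)⁸`; adding signs yields two
linear relations among `m₈`, `∫x₀⁶x_a²`, `∫x₀⁴x_a⁴`, whose elimination of `∫x₀⁴x_a⁴` is **`∫ x₀⁶ x_a² = m₈/7`** (`integral_six_two_of_rotations`);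
finally the unitarity row sum multiplied by `x₀⁶`: `m₈ + 3·(m₈/7) = ∫ x₀⁶ = 5/64` (part 17), hence ★ **`m₈ = 7/128`** and
★★ **`∫ (Re tr ρ(g))⁸ dg = 256 m₈ = 14`** — the Catalan number `C₄`, the number of invariants in `V^{⊗8}`, the eighth moment of the
Sato–Tate law; also `∫ (Re tr)⁷ = 0`. The even Haar moments of `Re tr U` of orders `2, 4, 6, 8` are `1, 2, 5, 14`. References:
T. Bröcker, T. tom Dieck, GTM 98 (1985) II §5. Everything here is proved. [folklore]
-/

noncomputable section

open MeasureTheory Complex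
open Literature.MathematicalPhysics.QuantumLattice Literature.MathematicalPhysics.QuantumFieldTheory
open scoped Quaternion

namespace Summit.Ventures.YMGap.HaarEighthMoment

open Summit.Ventures.YMGap.HaarFourthMoment (integral_comp_quat continuous_coords sum_sq_eq_one reTr_eq_two_mul)
open Summit.Ventures.YMGap.HaarSixthMoment (integral_re00_pow_six)

section Model

variable {G : Type*} [Group G] [TopologicalSpace G] [IsTopologicalGroup G] [CompactSpace G]
  [MeasurableSpace G] [BorelSpace G] (ρ : G →* Matrix (Fin 2) (Fin 2) ℂ)

/-! ### Eighth moments of single coordinates and the swap `∫ x₀² x_a⁶ = ∫ x₀⁶ x_a²` (`q = i, j, k`) -/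

/-- `∫ (Im U₀₀)⁸ = ∫ (Re U₀₀)⁸` and `∫ (Re U₀₀)²(Im U₀₀)⁶ = ∫ (Re U₀₀)⁶(Im U₀₀)²` (left twist by `quatMatrix i`).
[folklore] -/
theorem im00_eight_and_swap (hρ : IsSpecialUnitaryModel ρ) :
    ∫ g, (ρ g 0 0).im ^ 8 ∂haarProbability G = ∫ g, (ρ g 0 0).re ^ 8 ∂haarProbability G ∧
      ∫ g, (ρ g 0 0).re ^ 2 * (ρ g 0 0).im ^ 6 ∂haarProbability G =
        ∫ g, (ρ g 0 0).re ^ 6 * (ρ g 0 0).im ^ 2 ∂haarProbability G := by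
  constructor
  · have h := integral_comp_quat ρ hρ (a := 0) (b := 1) (c := 0) (d := 0) (by norm_num) (fun s _ _ _ => s ^ 8)
    have hpt : ∀ g : G, ((0 : ℝ) * (ρ g 0 0).re - 1 * (ρ g 0 0).im - 0 * (ρ g 0 1).re - 0 * (ρ g 0 1).im) ^ 8 = (ρ g 0 0).im ^ 8 := fun g => by ring
    simp only [hpt] at h
    exact h
  · have h := integral_comp_quat ρ hρ (a := 0) (b := 1) (c := 0) (d := 0) (by norm_num)
      (fun s t _ _ => s ^ 6 * t ^ 2)
    have hpt : ∀ g : G, ((0 : ℝ) * (ρ g 0 0).re - 1 * (ρ g 0 0).im - 0 * (ρ g 0 1).re - 0 * (ρ g 0 1).im) ^ 6 * ((0 : ℝ) * (ρ g 0 0).im + 1 * (ρ g 0 0).re + 0 * (ρ g 0 1).im - 0 * (ρ g 0 1).re) ^ 2 = (ρ g 0 0).re ^ 2 * (ρ g 0 0).im ^ 6 := fun g => by ring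
    simp only [hpt] at h
    exact h

/-- `∫ (Re U₀₁)⁸ = ∫ (Re U₀₀)⁸` and `∫ (Re U₀₀)²(Re U₀₁)⁶ = ∫ (Re U₀₀)⁶(Re U₀₁)²` (left twist by `quatMatrix j`).
[folklore] -/
theorem re01_eight_and_swap (hρ : IsSpecialUnitaryModel ρ) :
    ∫ g, (ρ g 0 1).re ^ 8 ∂haarProbability G = ∫ g, (ρ g 0 0).re ^ 8 ∂haarProbability G ∧
      ∫ g, (ρ g 0 0).re ^ 2 * (ρ g 0 1).re ^ 6 ∂haarProbability G =
        ∫ g, (ρ g 0 0).re ^ 6 * (ρ g 0 1).re ^ 2 ∂haarProbability G := by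
  constructor
  · have h := integral_comp_quat ρ hρ (a := 0) (b := 0) (c := 1) (d := 0) (by norm_num) (fun s _ _ _ => s ^ 8)
    have hpt : ∀ g : G, ((0 : ℝ) * (ρ g 0 0).re - 0 * (ρ g 0 0).im - 1 * (ρ g 0 1).re - 0 * (ρ g 0 1).im) ^ 8 = (ρ g 0 1).re ^ 8 := fun g => by ring
    simp only [hpt] at h
    exact h
  · have h := integral_comp_quat ρ hρ (a := 0) (b := 0) (c := 1) (d := 0) (by norm_num)
      (fun s _ u _ => s ^ 6 * u ^ 2)
    have hpt : ∀ g : G, ((0 : ℝ) * (ρ g 0 0).re - 0 * (ρ g 0 0).im - 1 * (ρ g 0 1).re - 0 * (ρ g 0 1).im) ^ 6 * ((0 : ℝ) * (ρ g 0 1).re - 0 * (ρ g 0 1).im + 1 * (ρ g 0 0).re + 0 * (ρ g 0 0).im) ^ 2 = (ρ g 0 0).re ^ 2 * (ρ g 0 1).re ^ 6 := fun g => by ring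
    simp only [hpt] at h
    exact h

/-- `∫ (Im U₀₁)⁸ = ∫ (Re U₀₀)⁸` and `∫ (Re U₀₀)²(Im U₀₁)⁶ = ∫ (Re U₀₀)⁶(Im U₀₁)²` (left twist by `quatMatrix k`).
[folklore] -/
theorem im01_eight_and_swap (hρ : IsSpecialUnitaryModel ρ) :
    ∫ g, (ρ g 0 1).im ^ 8 ∂haarProbability G = ∫ g, (ρ g 0 0).re ^ 8 ∂haarProbability G ∧
      ∫ g, (ρ g 0 0).re ^ 2 * (ρ g 0 1).im ^ 6 ∂haarProbability G =
        ∫ g, (ρ g 0 0).re ^ 6 * (ρ g 0 1).im ^ 2 ∂haarProbability G := by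
  constructor
  · have h := integral_comp_quat ρ hρ (a := 0) (b := 0) (c := 0) (d := 1) (by norm_num) (fun s _ _ _ => s ^ 8)
    have hpt : ∀ g : G, ((0 : ℝ) * (ρ g 0 0).re - 0 * (ρ g 0 0).im - 0 * (ρ g 0 1).re - 1 * (ρ g 0 1).im) ^ 8 = (ρ g 0 1).im ^ 8 := fun g => by ring
    simp only [hpt] at h
    exact h
  · have h := integral_comp_quat ρ hρ (a := 0) (b := 0) (c := 0) (d := 1) (by norm_num)
      (fun s _ _ v => s ^ 6 * v ^ 2)
    have hpt : ∀ g : G, ((0 : ℝ) * (ρ g 0 0).re - 0 * (ρ g 0 0).im - 0 * (ρ g 0 1).re - 1 * (ρ g 0 1).im) ^ 6 * ((0 : ℝ) * (ρ g 0 1).im + 0 * (ρ g 0 1).re - 0 * (ρ g 0 0).im + 1 * (ρ g 0 0).re) ^ 2 = (ρ g 0 0).re ^ 2 * (ρ g 0 1).im ^ 6 := fun g => by ring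
    simp only [hpt] at h
    exact h

/-! ### Mixed moments: `∫ x₀⁶ x_a² = (∫ x₀⁸)/7` (the rotations `q = (3 ± 4e_a)/5` and `q = (5 ± 12e_a)/13`) -/

/-- The bookkeeping step: from `∫ ((3x₀ ∓ 4y)/5)⁸ = ∫ ((5x₀ ∓ 12y)/13)⁸ = ∫ x₀⁸ = ∫ y⁸` and the swap `∫ x₀² y⁶ = ∫ x₀⁶ y²`
conclude `∫ x₀⁶ y² = (∫ x₀⁸)/7` (the unknown `∫ x₀⁴ y⁴` is eliminated between the two angles). [folklore] -/
theorem integral_six_two_of_rotations {x y : G → ℝ} (hx : Continuous x) (hy : Continuous y)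
    (hm : ∫ g, ((3 * x g - 4 * y g) / 5) ^ 8 ∂haarProbability G = ∫ g, x g ^ 8 ∂haarProbability G)
    (hp : ∫ g, ((3 * x g + 4 * y g) / 5) ^ 8 ∂haarProbability G = ∫ g, x g ^ 8 ∂haarProbability G)
    (hm' : ∫ g, ((5 * x g - 12 * y g) / 13) ^ 8 ∂haarProbability G = ∫ g, x g ^ 8 ∂haarProbability G)
    (hp' : ∫ g, ((5 * x g + 12 * y g) / 13) ^ 8 ∂haarProbability G = ∫ g, x g ^ 8 ∂haarProbability G)
    (hy8 : ∫ g, y g ^ 8 ∂haarProbability G = ∫ g, x g ^ 8 ∂haarProbability G)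
    (hsw : ∫ g, x g ^ 2 * y g ^ 6 ∂haarProbability G = ∫ g, x g ^ 6 * y g ^ 2 ∂haarProbability G) :
    ∫ g, x g ^ 6 * y g ^ 2 ∂haarProbability G = (∫ g, x g ^ 8 ∂haarProbability G) / 7 := by
  have iA : Integrable (fun g => x g ^ 8) (haarProbability G) :=
    Continuous.integrable_of_hasCompactSupport (by fun_prop) (HasCompactSupport.of_compactSpace _)
  have iB : Integrable (fun g => x g ^ 6 * y g ^ 2) (haarProbability G) :=
    Continuous.integrable_of_hasCompactSupport (by fun_prop) (HasCompactSupport.of_compactSpace _)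
  have iC : Integrable (fun g => x g ^ 4 * y g ^ 4) (haarProbability G) :=
    Continuous.integrable_of_hasCompactSupport (by fun_prop) (HasCompactSupport.of_compactSpace _)
  have iD : Integrable (fun g => x g ^ 2 * y g ^ 6) (haarProbability G) :=
    Continuous.integrable_of_hasCompactSupport (by fun_prop) (HasCompactSupport.of_compactSpace _)
  have iE : Integrable (fun g => y g ^ 8) (haarProbability G) :=
    Continuous.integrable_of_hasCompactSupport (by fun_prop) (HasCompactSupport.of_compactSpace _)
  -- the expansion `Σ_± ((a x ∓ b y)/c)⁸ = k₀ x⁸ + k₂ x⁶y² + k₄ x⁴y⁴ + k₆ x²y⁶ + k₈ y⁸`, integrated termwise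
  have expand : ∀ (k₀ k₂ k₄ k₆ k₈ : ℝ) (u : G → ℝ), (∀ g, u g = k₀ * x g ^ 8 + k₂ * (x g ^ 6 * y g ^ 2) +
      k₄ * (x g ^ 4 * y g ^ 4) + k₆ * (x g ^ 2 * y g ^ 6) + k₈ * y g ^ 8) →
      ∫ g, u g ∂haarProbability G = k₀ * ∫ g, x g ^ 8 ∂haarProbability G + k₂ * ∫ g, x g ^ 6 * y g ^ 2 ∂haarProbability G +
        k₄ * ∫ g, x g ^ 4 * y g ^ 4 ∂haarProbability G + k₆ * ∫ g, x g ^ 2 * y g ^ 6 ∂haarProbability G +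
        k₈ * ∫ g, y g ^ 8 ∂haarProbability G := by
    intro k₀ k₂ k₄ k₆ k₈ u hu
    have i0 := iA.const_mul k₀
    have i2 := iB.const_mul k₂
    have i4 := iC.const_mul k₄
    have i6 := iD.const_mul k₆
    have i8 := iE.const_mul k₈
    have i02 : Integrable (fun g => k₀ * x g ^ 8 + k₂ * (x g ^ 6 * y g ^ 2)) (haarProbability G) := i0.add i2
    have i024 : Integrable (fun g => k₀ * x g ^ 8 + k₂ * (x g ^ 6 * y g ^ 2) + k₄ * (x g ^ 4 * y g ^ 4))
        (haarProbability G) := i02.add i4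
    have i0246 : Integrable (fun g => k₀ * x g ^ 8 + k₂ * (x g ^ 6 * y g ^ 2) + k₄ * (x g ^ 4 * y g ^ 4) +
        k₆ * (x g ^ 2 * y g ^ 6)) (haarProbability G) := i024.add i6
    rw [integral_congr_ae (Filter.Eventually.of_forall hu), integral_add i0246 i8, integral_add i024 i6,
      integral_add i02 i4, integral_add i0 i2, integral_const_mul, integral_const_mul, integral_const_mul,
      integral_const_mul, integral_const_mul]
  have i1 : Integrable (fun g => ((3 * x g - 4 * y g) / 5) ^ 8) (haarProbability G) :=
    Continuous.integrable_of_hasCompactSupport (by fun_prop) (HasCompactSupport.of_compactSpace _)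
  have i1' : Integrable (fun g => ((3 * x g + 4 * y g) / 5) ^ 8) (haarProbability G) :=
    Continuous.integrable_of_hasCompactSupport (by fun_prop) (HasCompactSupport.of_compactSpace _)
  have i2 : Integrable (fun g => ((5 * x g - 12 * y g) / 13) ^ 8) (haarProbability G) :=
    Continuous.integrable_of_hasCompactSupport (by fun_prop) (HasCompactSupport.of_compactSpace _)
  have i2' : Integrable (fun g => ((5 * x g + 12 * y g) / 13) ^ 8) (haarProbability G) :=
    Continuous.integrable_of_hasCompactSupport (by fun_prop) (HasCompactSupport.of_compactSpace _)
  have s1 : ∫ g, (((3 * x g - 4 * y g) / 5) ^ 8 + ((3 * x g + 4 * y g) / 5) ^ 8) ∂haarProbability G =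
      2 * ∫ g, x g ^ 8 ∂haarProbability G := by rw [integral_add i1 i1', hm, hp]; ring
  have s2 : ∫ g, (((5 * x g - 12 * y g) / 13) ^ 8 + ((5 * x g + 12 * y g) / 13) ^ 8) ∂haarProbability G =
      2 * ∫ g, x g ^ 8 ∂haarProbability G := by rw [integral_add i2 i2', hm', hp']; ring
  rw [expand (13122 / 390625) (653184 / 390625) (2903040 / 390625) (2064384 / 390625) (131072 / 390625) _
    (fun g => by ring)] at s1
  rw [expand (781250 / 815730721) (126000000 / 815730721) (1814400000 / 815730721) (4180377600 / 815730721)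
    (859963392 / 815730721) _ (fun g => by ring)] at s2
  rw [hy8, hsw] at s1 s2
  linarith

/-- `∫ (Re U₀₀)⁶ (Im U₀₀)² = (∫ (Re U₀₀)⁸)/7` (rotations by `(3 ± 4i)/5` and `(5 ± 12i)/13`). [folklore] -/
theorem integral_re00_six_mul_im00_sq (hρ : IsSpecialUnitaryModel ρ) :
    ∫ g, (ρ g 0 0).re ^ 6 * (ρ g 0 0).im ^ 2 ∂haarProbability G =
      (∫ g, (ρ g 0 0).re ^ 8 ∂haarProbability G) / 7 := by
  obtain ⟨c0, c1, c2, c3⟩ := continuous_coords ρ hρ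
  obtain ⟨h8, hsw⟩ := im00_eight_and_swap ρ hρ
  refine integral_six_two_of_rotations c0 (by assumption) ?_ ?_ ?_ ?_ h8 hsw
  · have h := integral_comp_quat ρ hρ (a := 3 / 5) (b := 4 / 5) (c := 0) (d := 0) (by norm_num)
      (fun s _ _ _ => s ^ 8)
    have hpt : ∀ g : G, ((3 / 5 : ℝ) * (ρ g 0 0).re - 4 / 5 * (ρ g 0 0).im - 0 * (ρ g 0 1).re - 0 * (ρ g 0 1).im) ^ 8
        = ((3 * (ρ g 0 0).re - 4 * (ρ g 0 0).im) / 5) ^ 8 := fun g => by ring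
    simp only [hpt] at h
    exact h
  · have h := integral_comp_quat ρ hρ (a := 3 / 5) (b := -(4 / 5)) (c := 0) (d := 0) (by norm_num)
      (fun s _ _ _ => s ^ 8)
    have hpt : ∀ g : G, ((3 / 5 : ℝ) * (ρ g 0 0).re - -(4 / 5) * (ρ g 0 0).im - 0 * (ρ g 0 1).re - 0 * (ρ g 0 1).im) ^ 8
        = ((3 * (ρ g 0 0).re + 4 * (ρ g 0 0).im) / 5) ^ 8 := fun g => by ring
    simp only [hpt] at h
    exact h
  · have h := integral_comp_quat ρ hρ (a := 5 / 13) (b := 12 / 13) (c := 0) (d := 0) (by norm_num)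
      (fun s _ _ _ => s ^ 8)
    have hpt : ∀ g : G, ((5 / 13 : ℝ) * (ρ g 0 0).re - 12 / 13 * (ρ g 0 0).im - 0 * (ρ g 0 1).re - 0 * (ρ g 0 1).im) ^ 8
        = ((5 * (ρ g 0 0).re - 12 * (ρ g 0 0).im) / 13) ^ 8 := fun g => by ring
    simp only [hpt] at h
    exact h
  · have h := integral_comp_quat ρ hρ (a := 5 / 13) (b := -(12 / 13)) (c := 0) (d := 0) (by norm_num)
      (fun s _ _ _ => s ^ 8)
    have hpt : ∀ g : G, ((5 / 13 : ℝ) * (ρ g 0 0).re - -(12 / 13) * (ρ g 0 0).im - 0 * (ρ g 0 1).re - 0 * (ρ g 0 1).im) ^ 8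
        = ((5 * (ρ g 0 0).re + 12 * (ρ g 0 0).im) / 13) ^ 8 := fun g => by ring
    simp only [hpt] at h
    exact h

/-- `∫ (Re U₀₀)⁶ (Re U₀₁)² = (∫ (Re U₀₀)⁸)/7` (rotations by `(3 ± 4j)/5` and `(5 ± 12j)/13`). [folklore] -/
theorem integral_re00_six_mul_re01_sq (hρ : IsSpecialUnitaryModel ρ) :
    ∫ g, (ρ g 0 0).re ^ 6 * (ρ g 0 1).re ^ 2 ∂haarProbability G =
      (∫ g, (ρ g 0 0).re ^ 8 ∂haarProbability G) / 7 := by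
  obtain ⟨c0, c1, c2, c3⟩ := continuous_coords ρ hρ
  obtain ⟨h8, hsw⟩ := re01_eight_and_swap ρ hρ
  refine integral_six_two_of_rotations c0 (by assumption) ?_ ?_ ?_ ?_ h8 hsw
  · have h := integral_comp_quat ρ hρ (a := 3 / 5) (b := 0) (c := 4 / 5) (d := 0) (by norm_num)
      (fun s _ _ _ => s ^ 8)
    have hpt : ∀ g : G, ((3 / 5 : ℝ) * (ρ g 0 0).re - 0 * (ρ g 0 0).im - 4 / 5 * (ρ g 0 1).re - 0 * (ρ g 0 1).im) ^ 8
        = ((3 * (ρ g 0 0).re - 4 * (ρ g 0 1).re) / 5) ^ 8 := fun g => by ring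
    simp only [hpt] at h
    exact h
  · have h := integral_comp_quat ρ hρ (a := 3 / 5) (b := 0) (c := -(4 / 5)) (d := 0) (by norm_num)
      (fun s _ _ _ => s ^ 8)
    have hpt : ∀ g : G, ((3 / 5 : ℝ) * (ρ g 0 0).re - 0 * (ρ g 0 0).im - -(4 / 5) * (ρ g 0 1).re - 0 * (ρ g 0 1).im) ^ 8
        = ((3 * (ρ g 0 0).re + 4 * (ρ g 0 1).re) / 5) ^ 8 := fun g => by ring
    simp only [hpt] at h
    exact h
  · have h := integral_comp_quat ρ hρ (a := 5 / 13) (b := 0) (c := 12 / 13) (d := 0) (by norm_num)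
      (fun s _ _ _ => s ^ 8)
    have hpt : ∀ g : G, ((5 / 13 : ℝ) * (ρ g 0 0).re - 0 * (ρ g 0 0).im - 12 / 13 * (ρ g 0 1).re - 0 * (ρ g 0 1).im) ^ 8
        = ((5 * (ρ g 0 0).re - 12 * (ρ g 0 1).re) / 13) ^ 8 := fun g => by ring
    simp only [hpt] at h
    exact h
  · have h := integral_comp_quat ρ hρ (a := 5 / 13) (b := 0) (c := -(12 / 13)) (d := 0) (by norm_num)
      (fun s _ _ _ => s ^ 8)
    have hpt : ∀ g : G, ((5 / 13 : ℝ) * (ρ g 0 0).re - 0 * (ρ g 0 0).im - -(12 / 13) * (ρ g 0 1).re - 0 * (ρ g 0 1).im) ^ 8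
        = ((5 * (ρ g 0 0).re + 12 * (ρ g 0 1).re) / 13) ^ 8 := fun g => by ring
    simp only [hpt] at h
    exact h

/-- `∫ (Re U₀₀)⁶ (Im U₀₁)² = (∫ (Re U₀₀)⁸)/7` (rotations by `(3 ± 4k)/5` and `(5 ± 12k)/13`). [folklore] -/
theorem integral_re00_six_mul_im01_sq (hρ : IsSpecialUnitaryModel ρ) :
    ∫ g, (ρ g 0 0).re ^ 6 * (ρ g 0 1).im ^ 2 ∂haarProbability G =
      (∫ g, (ρ g 0 0).re ^ 8 ∂haarProbability G) / 7 := by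
  obtain ⟨c0, c1, c2, c3⟩ := continuous_coords ρ hρ
  obtain ⟨h8, hsw⟩ := im01_eight_and_swap ρ hρ
  refine integral_six_two_of_rotations c0 (by assumption) ?_ ?_ ?_ ?_ h8 hsw
  · have h := integral_comp_quat ρ hρ (a := 3 / 5) (b := 0) (c := 0) (d := 4 / 5) (by norm_num)
      (fun s _ _ _ => s ^ 8)
    have hpt : ∀ g : G, ((3 / 5 : ℝ) * (ρ g 0 0).re - 0 * (ρ g 0 0).im - 0 * (ρ g 0 1).re - 4 / 5 * (ρ g 0 1).im) ^ 8
        = ((3 * (ρ g 0 0).re - 4 * (ρ g 0 1).im) / 5) ^ 8 := fun g => by ring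
    simp only [hpt] at h
    exact h
  · have h := integral_comp_quat ρ hρ (a := 3 / 5) (b := 0) (c := 0) (d := -(4 / 5)) (by norm_num)
      (fun s _ _ _ => s ^ 8)
    have hpt : ∀ g : G, ((3 / 5 : ℝ) * (ρ g 0 0).re - 0 * (ρ g 0 0).im - 0 * (ρ g 0 1).re - -(4 / 5) * (ρ g 0 1).im) ^ 8
        = ((3 * (ρ g 0 0).re + 4 * (ρ g 0 1).im) / 5) ^ 8 := fun g => by ring
    simp only [hpt] at h
    exact h
  · have h := integral_comp_quat ρ hρ (a := 5 / 13) (b := 0) (c := 0) (d := 12 / 13) (by norm_num)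
      (fun s _ _ _ => s ^ 8)
    have hpt : ∀ g : G, ((5 / 13 : ℝ) * (ρ g 0 0).re - 0 * (ρ g 0 0).im - 0 * (ρ g 0 1).re - 12 / 13 * (ρ g 0 1).im) ^ 8
        = ((5 * (ρ g 0 0).re - 12 * (ρ g 0 1).im) / 13) ^ 8 := fun g => by ring
    simp only [hpt] at h
    exact h
  · have h := integral_comp_quat ρ hρ (a := 5 / 13) (b := 0) (c := 0) (d := -(12 / 13)) (by norm_num)
      (fun s _ _ _ => s ^ 8)
    have hpt : ∀ g : G, ((5 / 13 : ℝ) * (ρ g 0 0).re - 0 * (ρ g 0 0).im - 0 * (ρ g 0 1).re - -(12 / 13) * (ρ g 0 1).im) ^ 8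
        = ((5 * (ρ g 0 0).re + 12 * (ρ g 0 1).im) / 13) ^ 8 := fun g => by ring
    simp only [hpt] at h
    exact h

/-! ### The eighth moment -/

/-- ★ **THE HAAR EIGHTH MOMENT OF AN `SU(2)` ENTRY: `∫ (Re ρ(g)₀₀)⁸ dg = 7/128`** — the eighth moment of a coordinate of a
uniform point on `S³` (`E[u₀⁸] = 105/(n(n+2)(n+4)(n+6)) = 7/128` for `n = 4`). [folklore] -/
theorem integral_re00_pow_eight (hρ : IsSpecialUnitaryModel ρ) :
    ∫ g, (ρ g 0 0).re ^ 8 ∂haarProbability G = 7 / 128 := by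
  obtain ⟨c0, c1, c2, c3⟩ := continuous_coords ρ hρ
  -- integrate `x₀⁶ · (x₀² + x₁² + x₂² + x₃²) = x₀⁶`
  have hpt : ∀ g : G, (ρ g 0 0).re ^ 6 =
      (ρ g 0 0).re ^ 8 + (ρ g 0 0).re ^ 6 * (ρ g 0 0).im ^ 2 + (ρ g 0 0).re ^ 6 * (ρ g 0 1).re ^ 2 +
        (ρ g 0 0).re ^ 6 * (ρ g 0 1).im ^ 2 := by
    intro g
    have h1 := sum_sq_eq_one ρ hρ g
    linear_combination -((ρ g 0 0).re ^ 6 * h1)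
  have hq : ∫ g, ((ρ g 0 0).re ^ 8 + (ρ g 0 0).re ^ 6 * (ρ g 0 0).im ^ 2 + (ρ g 0 0).re ^ 6 * (ρ g 0 1).re ^ 2 +
      (ρ g 0 0).re ^ 6 * (ρ g 0 1).im ^ 2) ∂haarProbability G = 5 / 64 := by
    rw [← integral_re00_pow_six ρ hρ]
    exact integral_congr_ae (Filter.Eventually.of_forall fun g => (hpt g).symm)
  have hi1 : Integrable (fun g => (ρ g 0 0).re ^ 8) (haarProbability G) :=
    Continuous.integrable_of_hasCompactSupport (by fun_prop) (HasCompactSupport.of_compactSpace _)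
  have hi2 : Integrable (fun g => (ρ g 0 0).re ^ 6 * (ρ g 0 0).im ^ 2) (haarProbability G) :=
    Continuous.integrable_of_hasCompactSupport (by fun_prop) (HasCompactSupport.of_compactSpace _)
  have hi3 : Integrable (fun g => (ρ g 0 0).re ^ 6 * (ρ g 0 1).re ^ 2) (haarProbability G) :=
    Continuous.integrable_of_hasCompactSupport (by fun_prop) (HasCompactSupport.of_compactSpace _)
  have hi4 : Integrable (fun g => (ρ g 0 0).re ^ 6 * (ρ g 0 1).im ^ 2) (haarProbability G) :=
    Continuous.integrable_of_hasCompactSupport (by fun_prop) (HasCompactSupport.of_compactSpace _)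
  have hi12 : Integrable (fun g => (ρ g 0 0).re ^ 8 + (ρ g 0 0).re ^ 6 * (ρ g 0 0).im ^ 2) (haarProbability G) :=
    hi1.add hi2
  have hi123 : Integrable (fun g => (ρ g 0 0).re ^ 8 + (ρ g 0 0).re ^ 6 * (ρ g 0 0).im ^ 2 +
      (ρ g 0 0).re ^ 6 * (ρ g 0 1).re ^ 2) (haarProbability G) := hi12.add hi3
  rw [integral_add hi123 hi4, integral_add hi12 hi3, integral_add hi1 hi2,
    integral_re00_six_mul_im00_sq ρ hρ, integral_re00_six_mul_re01_sq ρ hρ, integral_re00_six_mul_im01_sq ρ hρ] at hq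
  linarith

/-- ★★ **THE HAAR EIGHTH MOMENT OF THE `SU(2)` CHARACTER: `∫ (Re tr ρ(g))⁸ dg = 14`** for every compact group `G ≅ SU(2)` —
the Catalan number `C₄`, the number of invariants in `V^{⊗8}`. [folklore] -/
theorem integral_reTr_pow_eight (hρ : IsSpecialUnitaryModel ρ) :
    ∫ g, PlaquetteLowerBound.reTr ρ g ^ 8 ∂haarProbability G = 14 := by
  simp_rw [reTr_eq_two_mul ρ hρ, mul_pow]
  rw [integral_const_mul, integral_re00_pow_eight ρ hρ]
  norm_num

/-- ★ `∫ (½ Re tr ρ(g))⁸ dg = 7/128` — the Haar eighth moment of the plaquette variable `W = ½ Re tr U`. [folklore] -/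
theorem integral_half_reTr_pow_eight (hρ : IsSpecialUnitaryModel ρ) :
    ∫ g, ((2 : ℝ)⁻¹ * PlaquetteLowerBound.reTr ρ g) ^ 8 ∂haarProbability G = 7 / 128 := by
  simp_rw [mul_pow]
  rw [integral_const_mul, integral_reTr_pow_eight ρ hρ]
  norm_num

/-- **The odd moments vanish: `∫ (Re tr ρ(g))⁷ dg = 0`** (centre twist by `−1`). [folklore] -/
theorem integral_reTr_pow_seven (hρ : IsSpecialUnitaryModel ρ) :
    ∫ g, PlaquetteLowerBound.reTr ρ g ^ 7 ∂haarProbability G = 0 := by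
  have h := integral_comp_quat ρ hρ (a := -1) (b := 0) (c := 0) (d := 0) (by norm_num) (fun s _ _ _ => (2 * s) ^ 7)
  have hpt : ∀ g : G, (2 * ((-1 : ℝ) * (ρ g 0 0).re - 0 * (ρ g 0 0).im - 0 * (ρ g 0 1).re - 0 * (ρ g 0 1).im)) ^ 7 =
      -((2 * (ρ g 0 0).re) ^ 7) := fun g => by ring
  simp only [hpt, integral_neg] at h
  simp_rw [reTr_eq_two_mul ρ hρ]
  linarith

end Model

/-! ### The concrete group `SU(2) = Matrix.specialUnitaryGroup (Fin 2) ℂ` -/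

/-- ★★ **`∫_{SU(2)} (Re tr U)⁸ dU = 14`** in the venture's vocabulary (`fundamentalRep (Fin 2)`). [folklore] -/
theorem integral_reTr_pow_eight_su2 :
    ∫ U, ((U : Matrix (Fin 2) (Fin 2) ℂ).trace.re) ^ 8 ∂haarProbability (Matrix.specialUnitaryGroup (Fin 2) ℂ) = 14 := by
  have h := integral_reTr_pow_eight (fundamentalRep (Fin 2)) (TorusAreaLaw.isSpecialUnitaryModel_fundamentalRep 2)
  simpa only [PlaquetteLowerBound.reTr, fundamentalRep_apply] using h

/-- ★ **`∫_{SU(2)} (½ Re tr U)⁸ dU = 7/128`.** [folklore] -/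
theorem integral_half_reTr_pow_eight_su2 :
    ∫ U, ((2 : ℝ)⁻¹ * (U : Matrix (Fin 2) (Fin 2) ℂ).trace.re) ^ 8 ∂haarProbability (Matrix.specialUnitaryGroup (Fin 2) ℂ) =
      7 / 128 := by
  have h := integral_half_reTr_pow_eight (fundamentalRep (Fin 2)) (TorusAreaLaw.isSpecialUnitaryModel_fundamentalRep 2)
  simpa only [PlaquetteLowerBound.reTr, fundamentalRep_apply] using h

end Summit.Ventures.YMGap.HaarEighthMoment
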